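import Summits.ResolutionOfSingularities.ResolutionOfSingularities.Theorems.SyzygyFlatteningDefs

/-!
# `RankOneTermination` without `A.FG` is false modulo a non-Noetherian rank-one valuation ring

Negative lemma for crux `RankOneTermination` (stmt-ResolutionOfSingularities-17044) of route
`SyzygyFlattening`: the hypothesis `A.FG` (the start of the tower is a finitely generated
`k`-algebra) is LOAD-BEARING.

* `chartSet_subset_valuationSubring`: every Plücker ratio adjoined by one step of the operator
  lies in `O` (it is `det (ι g) / det (ι x)` with `x` `O`-minimal) — for EVERY stage `B`.
* Hence on the stage `B = O` itself (the valuation ring as a `k`-subalgebra, `valSubalgebra`) the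
  operator is the identity: `locAt O B = B`, `chart O B = B`, `nrm B = B` (valuation rings are
  integrally closed), so `tower O B m = B` for all `m` (`tower_valSubalgebra`).
* `not_towerTerminates_valSubalgebra` (unconditional): if `O ⊇ k` is not Noetherian, the tower
  started at `A := O` never reaches a regular local ring.
* `rankOneTermination_false_without_FG`: the crux with the binder `A.FG →` deleted (all other
  binders verbatim, through the `Iff.rfl` vocabulary of `SyzygyFlatteningDefs`) is FALSE, modulo
  the hypothesis (H, stated inline) that some prime characteristic admits a rank-one,
  dimension-zero, non-Noetherian valuation ring `O ⊇ k` — e.g. the monomial valuation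
  `x ↦ 1, y ↦ √2` of `k(x,y)` (value group `ℤ + ℤ√2 ⊂ ℝ`, residue field `k`), an object not yet
  constructed in the tree.

Informal content for provers: the only place where finite generation of `A` enters the crux is
Noetherianity of the stages (existence of finite free resolutions / non-idling); on a
non-Noetherian rank-one valuation ring the tower is constant and never regular.
-/

noncomputable section

-- single-problem summit: the doubled namespace component `ResolutionOfSingularities` is forced
set_option linter.dupNamespace false

namespace Summit.ResolutionOfSingularities.ResolutionOfSingularities.Theorems.RankOneTermination.Negative

open Summit.ResolutionOfSingularities.ResolutionOfSingularities.Theses.SyzygyFlattening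
open Summit.ResolutionOfSingularities.ResolutionOfSingularities.Theorems.SyzygyFlattening

variable {k K : Type} [Field k] [Field K] [Algebra k K]

/-- **Every Plücker ratio adjoined by a step lies in the valuation ring**: an element of
`chartSet O B` is `det (ι g) * (det (ι x))⁻¹` with `x` `O`-minimal, and minimality applied to
`g' := g` is exactly membership in `O`. [folklore] -/
theorem chartSet_subset_valuationSubring (O : ValuationSubring K) (B : Subalgebra k K) :
    chartSet O B ⊆ (O : Set K) := by
  rintro y ⟨b, d, ε, r, ι, -, -, -, -, -, g, x, -, hmin, rfl⟩
  exact hmin g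

/-- **The valuation ring as a `k`-subalgebra of `K`** (available exactly when `k ⊆ O`).
[folklore] -/
def valSubalgebra (O : ValuationSubring K) (hk : ∀ c : k, algebraMap k K c ∈ O) :
    Subalgebra k K where
  carrier := O
  mul_mem' ha hb := O.mul_mem _ _ ha hb
  one_mem' := O.one_mem
  add_mem' ha hb := O.add_mem _ _ ha hb
  zero_mem' := O.zero_mem
  algebraMap_mem' := hk

section
variable (O : ValuationSubring K) (hk : ∀ c : k, algebraMap k K c ∈ O)

/-- Membership in `valSubalgebra O hk` is membership in `O`. [folklore] -/
@[simp] theorem mem_valSubalgebra {x : K} : x ∈ valSubalgebra O hk ↔ x ∈ O := Iff.rfl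

/-- The carrier of `valSubalgebra O hk` is `O`. [folklore] -/
theorem coe_valSubalgebra : ((valSubalgebra O hk : Subalgebra k K) : Set K) = O := rfl

/-- `valSubalgebra O hk` and `O` have the same underlying subring. [folklore] -/
theorem valSubalgebra_toSubring : (valSubalgebra O hk).toSubring = O.toSubring :=
  Subring.ext fun _ => Iff.rfl

/-- The ring isomorphism between `O` viewed as a `k`-subalgebra and `O` itself (same carrier).
[folklore] -/
def valSubalgebraEquiv : ↥(valSubalgebra O hk) ≃+* ↥O where
  toFun x := ⟨x.1, x.2⟩
  invFun x := ⟨x.1, x.2⟩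
  left_inv _ := rfl
  right_inv _ := rfl
  map_mul' _ _ := rfl
  map_add' _ _ := rfl

/-- `O` (as a `k`-subalgebra) is a fraction ring of `K`: every `z : K` is `z/1` or `1/z⁻¹`.
[folklore] -/
theorem isFractionRing_valSubalgebra : IsFractionRing ↥(valSubalgebra O hk) K := by
  haveI : FaithfulSMul ↥(valSubalgebra O hk) K :=
    (faithfulSMul_iff_algebraMap_injective _ K).mpr Subtype.val_injective
  refine IsFractionRing.of_field (R := ↥(valSubalgebra O hk)) (K := K) fun z => ?_
  rcases O.mem_or_inv_mem z with hz | hz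
  · exact ⟨⟨z, hz⟩, 1, by simp⟩
  · refine ⟨1, ⟨z⁻¹, hz⟩, ?_⟩
    simp

/-- **Stage `0` is `O`**: localising `O` at its own centre changes nothing. [folklore] -/
theorem locAt_valSubalgebra : locAt O (valSubalgebra O hk) = valSubalgebra O hk := by
  have hset : {y : K | ∃ a ∈ valSubalgebra O hk, ∃ s ∈ valSubalgebra O hk, s⁻¹ ∈ O ∧ y = a * s⁻¹}
      = ((valSubalgebra O hk : Subalgebra k K) : Set K) := by
    ext y
    simp only [Set.mem_setOf_eq, mem_valSubalgebra, SetLike.mem_coe]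
    constructor
    · rintro ⟨a, ha, s, -, hs, rfl⟩
      exact O.mul_mem _ _ ha hs
    · intro hy
      exact ⟨y, hy, 1, O.one_mem, by simp [O.one_mem], by simp⟩
  unfold locAt
  rw [hset, Algebra.adjoin_eq]

/-- **The chart of `O` is `O`**: all Plücker ratios already lie in `O`. [folklore] -/
theorem chart_valSubalgebra : chart O (valSubalgebra O hk) = valSubalgebra O hk := by
  rw [chart_def]
  have hU : ((valSubalgebra O hk : Subalgebra k K) : Set K) ∪ chartSet O (valSubalgebra O hk)
      = ((valSubalgebra O hk : Subalgebra k K) : Set K) :=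
    Set.union_eq_self_of_subset_right (chartSet_subset_valuationSubring O _)
  rw [hU, Algebra.adjoin_eq]

/-- **The normalisation of `O` is `O`**: valuation rings are integrally closed in their fraction
field. [folklore] -/
theorem nrm_valSubalgebra : nrm (valSubalgebra O hk) = valSubalgebra O hk := by
  have hint : Valuation.Integers O.valuation ↥(valSubalgebra O hk) :=
    { hom_inj := Subtype.val_injective
      map_le_one := fun x => (O.valuation_le_one_iff _).mpr x.2
      exists_of_le_one := fun {x} hx => ⟨⟨x, (O.valuation_le_one_iff _).mp hx⟩, rfl⟩ }
  have hset : {y : K | IsIntegral ↥(valSubalgebra O hk) y}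
      = ((valSubalgebra O hk : Subalgebra k K) : Set K) := by
    ext y
    simp only [Set.mem_setOf_eq, SetLike.mem_coe, mem_valSubalgebra]
    rw [hint.isIntegral_iff_v_le_one, O.valuation_le_one_iff]
  unfold nrm
  rw [hset, Algebra.adjoin_eq]

/-- **The tower started at `O` is constant**: `tower O O m = O` for all `m`. [folklore] -/
theorem tower_valSubalgebra (m : ℕ) : tower O (valSubalgebra O hk) m = valSubalgebra O hk := by
  induction m with
  | zero => exact locAt_valSubalgebra O hk
  | succ m ih => rw [tower_succ, ih, chart_valSubalgebra, nrm_valSubalgebra, locAt_valSubalgebra]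

end

/-- **The tower from a non-Noetherian valuation ring never terminates**: if `k ⊆ O` and `O` is
not Noetherian then no stage of the tower started at `A := O` is a regular local ring (all
stages are `O`). Unconditional. [folklore] -/
theorem not_towerTerminates_valSubalgebra (O : ValuationSubring K)
    (hk : ∀ c : k, algebraMap k K c ∈ O) (hO : ¬ IsNoetherianRing ↥O) :
    ¬ TowerTerminates O (valSubalgebra O hk) := by
  rintro ⟨m, hreg⟩
  rw [tower_valSubalgebra] at hreg
  haveI : IsNoetherianRing ↥(valSubalgebra O hk) := hreg.toIsNoetherian
  exact hO (isNoetherianRing_of_ringEquiv _ (valSubalgebraEquiv O hk))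

/-- **`A.FG` is load-bearing in `RankOneTermination`.** The conclusion is the NEGATION of the
crux `RankOneTermination` with the single binder `A.FG →` deleted (every other binder verbatim,
through the `Iff.rfl` vocabulary `DimZero` / `TowerTerminates` of `SyzygyFlatteningDefs`, cf.
`rankOneTermination_iff`). The hypothesis (H) is the existence, in some prime characteristic, of
a rank-one (`ringKrullDim O = 1`), dimension-zero valuation ring `O ⊇ k` that is not Noetherian
— e.g. the valuation ring of the monomial valuation `x ↦ 1, y ↦ √2` on `k(x, y)` (value group
`ℤ + ℤ√2 ⊂ ℝ`, residue field `k`, maximal ideal idempotent); H is not yet constructed in the tree.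
Proof: take `A := O`; the tower is constantly `O` (`tower_valSubalgebra`), never Noetherian.
[folklore] -/
theorem rankOneTermination_false_without_FG
    (hH : ∃ (p : ℕ) (_ : p.Prime) (k K : Type) (_ : Field k) (_ : CharP k p) (_ : Field K)
      (_ : Algebra k K) (O : ValuationSubring K), (∀ c : k, algebraMap k K c ∈ O) ∧ DimZero k O ∧
      ringKrullDim ↥O = 1 ∧ ¬ IsNoetherianRing ↥O) :
    ¬ (∀ p : ℕ, p.Prime → ∀ (k K : Type) [Field k] [CharP k p] [Field K] [Algebra k K]
        (O : ValuationSubring K) (A : Subalgebra k K), (∀ c : k, algebraMap k K c ∈ O) →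
        IsFractionRing ↥A K → A.toSubring ≤ O.toSubring → DimZero k O → ringKrullDim ↥O = 1 →
        TowerTerminates O A) := by
  obtain ⟨p, hp, k, K, _, _, _, _, O, hk, hdz, hdim, hnoeth⟩ := hH
  intro h
  exact not_towerTerminates_valSubalgebra O hk hnoeth
    (h p hp k K O (valSubalgebra O hk) hk (isFractionRing_valSubalgebra O hk)
      (le_of_eq (valSubalgebra_toSubring O hk)) hdz hdim)

end Summit.ResolutionOfSingularities.ResolutionOfSingularities.Theorems.RankOneTermination.Negative

end
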